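import Summits.KontsevichZagierPeriods.KontsevichZagierPeriods.Theorems.RootDecompRelativeModAbsoluteCylLogSplitP16

/-! # `RootDecompRelativeModAbsoluteCylLogSplitP17` — part 17/25 of the mechanical ≤330-line split of `CylLogSplit.lean`
(split by the decomp-kz census seat for landing; mathematics unchanged; part 17 continues part 16). -/

noncomputable section
open Set MeasureTheory Filter Topology
open scoped BigOperators
open Literature.NumberTheory.Transcendental Literature.ModelTheory.ExponentialFields

namespace Summit.KontsevichZagierPeriods.RootDecompRelativeModAbsolute.Rung30571

namespace RegularisedLogLayer

namespace CylLog
variable {b : ℕ}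

/-- **D7 — GENERAL EXACT RELATION, both orientations (PROVED).**  Base `G` open `ℚ`-semialgebraic; `d` semialgebraic;
four finite families of semialgebraic differentiable units: `U, V ≥ 1` (cells `[band G 1 W]`) and `U', V' ∈ (0,1]`
(reversed cells `[band G W 1]`), all with the kernel `d·(t−1)^m/t`, satisfying the relation `(∏U)(∏U') = (∏V)(∏V')`
on `G`, the common value being oriented on `G`; honest base bounds for the four products.  Then the oriented signed sum
`(Σ[R] − Σ[R']) − (Σ[S] − Σ[S'])` differs from the BASE TERM
`[G, d·((Σ polyLog_m U + Σ polyLog_m U') − (Σ polyLog_m V + Σ polyLog_m V'))]` by an element of `KZ.relations`. -/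
theorem regCells_mem_relations_of_relation {b m k₁ k₂ l₁ l₂ : ℕ} {G : Set (Fin b → ℝ)}
    {d : (Fin b → ℝ) → ℝ}
    (hGo : IsOpen G) (hG : IsSemialgebraic ℚ G) (hd : IsSemialgebraicFunOn ℚ G d)
    (U : Fin k₁ → (Fin b → ℝ) → ℝ) (U' : Fin k₂ → (Fin b → ℝ) → ℝ)
    (V : Fin l₁ → (Fin b → ℝ) → ℝ) (V' : Fin l₂ → (Fin b → ℝ) → ℝ)
    (hU : ∀ i, IsSemialgebraicFunOn ℚ G (U i)) (hU' : ∀ i, IsSemialgebraicFunOn ℚ G (U' i))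
    (hV : ∀ j, IsSemialgebraicFunOn ℚ G (V j)) (hV' : ∀ j, IsSemialgebraicFunOn ℚ G (V' j))
    (hUd : ∀ i, DifferentiableOn ℝ (U i) G) (hU'd : ∀ i, DifferentiableOn ℝ (U' i) G)
    (hVd : ∀ j, DifferentiableOn ℝ (V j) G) (hV'd : ∀ j, DifferentiableOn ℝ (V' j) G)
    (hU1 : ∀ i, ∀ x ∈ G, 1 ≤ U i x) (hU'0 : ∀ i, ∀ x ∈ G, 0 < U' i x) (hU'1 : ∀ i, ∀ x ∈ G, U' i x ≤ 1)
    (hV1 : ∀ j, ∀ x ∈ G, 1 ≤ V j x) (hV'0 : ∀ j, ∀ x ∈ G, 0 < V' j x) (hV'1 : ∀ j, ∀ x ∈ G, V' j x ≤ 1)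
    (hrel : ∀ x ∈ G, (∏ i, U i x) * ∏ i, U' i x = (∏ j, V j x) * ∏ j, V' j x)
    (hL : (∀ x ∈ G, 1 ≤ (∏ i, U i x) * ∏ i, U' i x) ∨ (∀ x ∈ G, (∏ i, U i x) * ∏ i, U' i x ≤ 1))
    (hintU : IntegrableOn (fun x => d x * (∏ i, U i x - 1) ^ (m + 1)) G)
    (hintU' : IntegrableOn (fun x => d x * (1 - ∏ i, U' i x) ^ (m + 1) / ∏ i, U' i x) G)
    (hintV : IntegrableOn (fun x => d x * (∏ j, V j x - 1) ^ (m + 1)) G)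
    (hintV' : IntegrableOn (fun x => d x * (1 - ∏ j, V' j x) ^ (m + 1) / ∏ j, V' j x) G)
    (R : Fin k₁ → KZ.IntegralRep (b + 1)) (R' : Fin k₂ → KZ.IntegralRep (b + 1))
    (S : Fin l₁ → KZ.IntegralRep (b + 1)) (S' : Fin l₂ → KZ.IntegralRep (b + 1))
    (hRd : ∀ i, (R i).domain = KZlog.band G (fun _ => 1) (U i))
    (hRi : ∀ i, EqOn (R i).integrand
      (fun z => d (Fin.init z) * ((z (Fin.last b) - 1) ^ m / z (Fin.last b))) (R i).domain)
    (hR'd : ∀ i, (R' i).domain = KZlog.band G (U' i) (fun _ => 1))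
    (hR'i : ∀ i, EqOn (R' i).integrand
      (fun z => d (Fin.init z) * ((z (Fin.last b) - 1) ^ m / z (Fin.last b))) (R' i).domain)
    (hSd : ∀ j, (S j).domain = KZlog.band G (fun _ => 1) (V j))
    (hSi : ∀ j, EqOn (S j).integrand
      (fun z => d (Fin.init z) * ((z (Fin.last b) - 1) ^ m / z (Fin.last b))) (S j).domain)
    (hS'd : ∀ j, (S' j).domain = KZlog.band G (V' j) (fun _ => 1))
    (hS'i : ∀ j, EqOn (S' j).integrand
      (fun z => d (Fin.init z) * ((z (Fin.last b) - 1) ^ m / z (Fin.last b))) (S' j).domain) :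
    ∃ B : KZ.IntegralRep b, B.domain = G ∧
      (B.integrand = fun x => d x * ((∑ i, polyLog m (U i x) + ∑ i, polyLog m (U' i x)) -
        (∑ j, polyLog m (V j x) + ∑ j, polyLog m (V' j x)))) ∧
      (∑ i, KZ.of (R i) - ∑ i, KZ.of (R' i)) - (∑ j, KZ.of (S j) - ∑ j, KZ.of (S' j)) - KZ.of B ∈
        KZ.relations := by
  have hGm : MeasurableSet G := hG.measurableSet_holds
  -- the four oriented products
  have hA1 : ∀ x ∈ G, 1 ≤ ∏ i, U i x := fun x hx => one_le_fin_prod fun i => hU1 i x hx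
  have hB1 : ∀ x ∈ G, 1 ≤ ∏ j, V j x := fun x hx => one_le_fin_prod fun j => hV1 j x hx
  have hC0 : ∀ x ∈ G, 0 < ∏ i, U' i x := fun x hx => fin_prod_pos' fun i => hU'0 i x hx
  have hC1 : ∀ x ∈ G, ∏ i, U' i x ≤ 1 := fun x hx =>
    fin_prod_le_one' (fun i => hU'0 i x hx) fun i => hU'1 i x hx
  have hD0 : ∀ x ∈ G, 0 < ∏ j, V' j x := fun x hx => fin_prod_pos' fun j => hV'0 j x hx
  have hD1 : ∀ x ∈ G, ∏ j, V' j x ≤ 1 := fun x hx =>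
    fin_prod_le_one' (fun j => hV'0 j x hx) fun j => hV'1 j x hx
  have hAsa : IsSemialgebraicFunOn ℚ G (fun x => ∏ i, U i x) := isSemialgebraicFunOn_fin_prod hG hU
  have hBsa : IsSemialgebraicFunOn ℚ G (fun x => ∏ j, V j x) := isSemialgebraicFunOn_fin_prod hG hV
  have hCsa : IsSemialgebraicFunOn ℚ G (fun x => ∏ i, U' i x) := isSemialgebraicFunOn_fin_prod hG hU'
  have hDsa : IsSemialgebraicFunOn ℚ G (fun x => ∏ j, V' j x) := isSemialgebraicFunOn_fin_prod hG hV'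
  have hAd : DifferentiableOn ℝ (fun x => ∏ i, U i x) G := differentiableOn_fin_prod hUd
  have hBd : DifferentiableOn ℝ (fun x => ∏ j, V j x) G := differentiableOn_fin_prod hVd
  have hLsa : IsSemialgebraicFunOn ℚ G (fun x => (∏ i, U i x) * ∏ i, U' i x) :=
    IsSemialgebraicFunOn.mul_holds hAsa hCsa
  have hL0 : ∀ x ∈ G, 0 < (∏ i, U i x) * ∏ i, U' i x := fun x hx =>
    mul_pos (by linarith [hA1 x hx]) (hC0 x hx)
  have hLleA : ∀ x ∈ G, (∏ i, U i x) * ∏ i, U' i x ≤ ∏ i, U i x := fun x hx =>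
    mul_le_of_le_one_right (by linarith [hA1 x hx]) (hC1 x hx)
  have hCleL : ∀ x ∈ G, ∏ i, U' i x ≤ (∏ i, U i x) * ∏ i, U' i x := fun x hx =>
    le_mul_of_one_le_left (hC0 x hx).le (hA1 x hx)
  have hLV1 : ∀ x ∈ G, 1 ≤ (∏ i, U i x) * ∏ i, U' i x → 1 ≤ (∏ j, V j x) * ∏ j, V' j x :=
    fun x hx h => by rw [← hrel x hx]; exact h
  have hLV2 : ∀ x ∈ G, (∏ i, U i x) * ∏ i, U' i x ≤ 1 → (∏ j, V j x) * ∏ j, V' j x ≤ 1 :=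
    fun x hx h => by rw [← hrel x hx]; exact h
  -- the four iterations
  obtain ⟨PA, BA, hPAd, hPAi, hBAd, hBAi, h1⟩ :=
    regTorusProductPos_iter (m := m) hGo hG hd k₁ U hU hUd hU1 hintU R hRd hRi
  obtain ⟨PC, BC, hPCd, hPCi, hBCd, hBCi, h2⟩ :=
    regTorusProductNeg_iter (m := m) hGo hG hd k₂ U' hU' hU'd hU'0 hU'1 hintU' R' hR'd hR'i
  obtain ⟨PB, BB, hPBd, hPBi, hBBd, hBBi, h3⟩ :=
    regTorusProductPos_iter (m := m) hGo hG hd l₁ V hV hVd hV1 hintV S hSd hSi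
  obtain ⟨PD, BD, hPDd, hPDi, hBDd, hBDi, h4⟩ :=
    regTorusProductNeg_iter (m := m) hGo hG hd l₂ V' hV' hV'd hV'0 hV'1 hintV' S' hS'd hS'i
  -- the two junction defects
  obtain ⟨BAC, hBACd, hBACi⟩ :=
    exists_baseRep_rho_mixed (m := m) hG hd hAsa hCsa hA1 hC0 hC1 hintU hintU'
  obtain ⟨BBD, hBBDd, hBBDi⟩ :=
    exists_baseRep_rho_mixed (m := m) hG hd hBsa hDsa hB1 hD0 hD1 hintV hintV'
  -- the junctions (one Mixed pattern per side, the product cell shared)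
  have h56 : -KZ.of PA + KZ.of PC + KZ.of PB - KZ.of PD - KZ.of BAC + KZ.of BBD ∈ KZ.relations := by
    rcases hL with hL1 | hL2
    · -- `L ≥ 1`: pattern Mixed₁
      have hintL : IntegrableOn (fun x => d x * ((∏ i, U i x) * ∏ i, U' i x - 1) ^ (m + 1)) G := by
        have hsa : IsSemialgebraicFunOn ℚ G (fun x => d x * ((∏ i, U i x) * ∏ i, U' i x - 1) ^ (m + 1)) :=
          IsSemialgebraicFunOn.mul_holds hd (isSemialgebraicFunOn_pow' hG
            ((IsSemialgebraicFunOn.sub_holds hLsa (isSemialgebraicFunOn_ratCast hG 1)).congr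
              fun x _ => by simp) (m + 1))
        refine Integrable.mono' hintU.norm (KZ.aestronglyMeasurable_of_isSemialgebraicFunOn hsa hGm) ?_
        filter_upwards [ae_restrict_mem hGm] with x hx
        rw [Real.norm_eq_abs, Real.norm_eq_abs, abs_mul, abs_mul,
          abs_of_nonneg (pow_nonneg (sub_nonneg.mpr (hL1 x hx)) (m + 1)),
          abs_of_nonneg (pow_nonneg (sub_nonneg.mpr (hA1 x hx)) (m + 1))]
        refine mul_le_mul_of_nonneg_left ?_ (abs_nonneg _)
        exact pow_le_pow_left₀ (sub_nonneg.mpr (hL1 x hx)) (by linarith [hLleA x hx]) _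
      obtain ⟨PL, hPLd, hPLi⟩ := exists_regRep_of_integrableOn_pow (m := m)
        (W := fun x => (∏ i, U i x) * ∏ i, U' i x) hG hd hLsa hL1 hintL
      have h5 : KZ.of PL - KZ.of PA + KZ.of PC - KZ.of BAC ∈ KZ.relations :=
        regTorusProductMixed₁ hGo hG hd hAsa hCsa hAd hA1 hC0 hC1 hL1 PL PA PC BAC
          hPLd (fun z _ => by rw [hPLi]) hPAd (fun z _ => by rw [hPAi]) hPCd (fun z _ => by rw [hPCi])
          hBACd (fun x _ => by rw [hBACi])
      have h6 : KZ.of PL - KZ.of PB + KZ.of PD - KZ.of BBD ∈ KZ.relations :=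
        regTorusProductMixed₁ hGo hG hd hBsa hDsa hBd hB1 hD0 hD1 (fun x hx => hLV1 x hx (hL1 x hx))
          PL PB PD BBD
          (hPLd.trans (KZlog.band_congr (a := fun _ => (1:ℝ)) fun x hx => hrel x hx))
          (fun z _ => by rw [hPLi]) hPBd (fun z _ => by rw [hPBi]) hPDd (fun z _ => by rw [hPDi])
          hBBDd (fun x _ => by rw [hBBDi])
      have e : -KZ.of PA + KZ.of PC + KZ.of PB - KZ.of PD - KZ.of BAC + KZ.of BBD =
          (KZ.of PL - KZ.of PA + KZ.of PC - KZ.of BAC) - (KZ.of PL - KZ.of PB + KZ.of PD - KZ.of BBD) := by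
        abel
      rw [e]
      exact sub_mem h5 h6
    · -- `L ≤ 1`: pattern Mixed₂
      have hintL : IntegrableOn (fun x => d x * (1 - (∏ i, U i x) * ∏ i, U' i x) ^ (m + 1) /
          ((∏ i, U i x) * ∏ i, U' i x)) G := by
        have hsa : IsSemialgebraicFunOn ℚ G (fun x => d x * (1 - (∏ i, U i x) * ∏ i, U' i x) ^ (m + 1) /
            ((∏ i, U i x) * ∏ i, U' i x)) :=
          IsSemialgebraicFunOn.div (IsSemialgebraicFunOn.mul_holds hd (isSemialgebraicFunOn_pow' hG
            ((IsSemialgebraicFunOn.sub_holds (isSemialgebraicFunOn_ratCast hG 1) hLsa).congr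
              fun x _ => by simp) (m + 1))) hLsa fun x hx => (hL0 x hx).ne'
        refine Integrable.mono' hintU'.norm (KZ.aestronglyMeasurable_of_isSemialgebraicFunOn hsa hGm) ?_
        filter_upwards [ae_restrict_mem hGm] with x hx
        rw [Real.norm_eq_abs, Real.norm_eq_abs, mul_div_assoc, mul_div_assoc, abs_mul, abs_mul,
          abs_of_nonneg (div_nonneg (pow_nonneg (sub_nonneg.mpr (hL2 x hx)) (m + 1)) (hL0 x hx).le),
          abs_of_nonneg (div_nonneg (pow_nonneg (sub_nonneg.mpr (hC1 x hx)) (m + 1)) (hC0 x hx).le)]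
        exact mul_le_mul_of_nonneg_left (gneg_mono m (hC0 x hx) (hCleL x hx) (hL2 x hx)) (abs_nonneg _)
      obtain ⟨PL, hPLd, hPLi⟩ := exists_regRep_of_integrableOn_pow' (m := m)
        (W := fun x => (∏ i, U i x) * ∏ i, U' i x) hG hd hLsa hL0 hL2 hintL
      have h5 : -KZ.of PL - KZ.of PA + KZ.of PC - KZ.of BAC ∈ KZ.relations :=
        regTorusProductMixed₂ hGo hG hd hAsa hCsa hAd hA1 hC0 hC1 hL2 PL PA PC BAC
          hPLd (fun z _ => by rw [hPLi]) hPAd (fun z _ => by rw [hPAi]) hPCd (fun z _ => by rw [hPCi])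
          hBACd (fun x _ => by rw [hBACi])
      have h6 : -KZ.of PL - KZ.of PB + KZ.of PD - KZ.of BBD ∈ KZ.relations :=
        regTorusProductMixed₂ hGo hG hd hBsa hDsa hBd hB1 hD0 hD1 (fun x hx => hLV2 x hx (hL2 x hx))
          PL PB PD BBD
          (hPLd.trans (band_congr_left fun x hx => hrel x hx))
          (fun z _ => by rw [hPLi]) hPBd (fun z _ => by rw [hPBi]) hPDd (fun z _ => by rw [hPDi])
          hBBDd (fun x _ => by rw [hBBDi])
      have e : -KZ.of PA + KZ.of PC + KZ.of PB - KZ.of PD - KZ.of BAC + KZ.of BBD =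
          (-KZ.of PL - KZ.of PA + KZ.of PC - KZ.of BAC) - (-KZ.of PL - KZ.of PB + KZ.of PD - KZ.of BBD) := by
        abel
      rw [e]
      exact sub_mem h5 h6
  -- grouping the base terms of each side
  obtain ⟨XU, hXUd, hXUi, rU⟩ := exists_rep_add3 hG BA BC BAC hBAd hBCd hBACd
  obtain ⟨XV, hXVd, hXVi, rV⟩ := exists_rep_add3 hG BB BD BBD hBBd hBDd hBBDd
  -- the final base term: the `polyLog_m(L)` contributions cancel by the relation
  have hFsa : IsSemialgebraicFunOn ℚ G (fun x => d x * ((∑ i, polyLog m (U i x) + ∑ i, polyLog m (U' i x)) -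
      (∑ j, polyLog m (V j x) + ∑ j, polyLog m (V' j x)))) := by
    refine IsSemialgebraicFunOn.mul_holds hd (IsSemialgebraicFunOn.sub_holds
      (IsSemialgebraicFunOn.add_holds ?_ ?_) (IsSemialgebraicFunOn.add_holds ?_ ?_))
    · exact KZ.isSemialgebraicFunOn_finset_sum Finset.univ hG fun i _ =>
        isSemialgebraicFunOn_polyLog_comp hG (hU i) m
    · exact KZ.isSemialgebraicFunOn_finset_sum Finset.univ hG fun i _ =>
        isSemialgebraicFunOn_polyLog_comp hG (hU' i) m
    · exact KZ.isSemialgebraicFunOn_finset_sum Finset.univ hG fun j _ =>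
        isSemialgebraicFunOn_polyLog_comp hG (hV j) m
    · exact KZ.isSemialgebraicFunOn_finset_sum Finset.univ hG fun j _ =>
        isSemialgebraicFunOn_polyLog_comp hG (hV' j) m
  have hsum : ∀ x ∈ G, XV.integrand x =
      d x * ((∑ i, polyLog m (U i x) + ∑ i, polyLog m (U' i x)) -
        (∑ j, polyLog m (V j x) + ∑ j, polyLog m (V' j x))) + XU.integrand x := by
    intro x hx
    rw [hXVi, hXUi]
    simp only [hBAi, hBCi, hBACi, hBBi, hBDi, hBBDi, rho]
    rw [← hrel x hx]
    ring
  have hXU_int : IntegrableOn XU.integrand G := by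
    have h := XU.integrableOn
    rwa [hXUd] at h
  have hXV_int : IntegrableOn XV.integrand G := by
    have h := XV.integrableOn
    rwa [hXVd] at h
  have hFint : IntegrableOn (fun x => d x * ((∑ i, polyLog m (U i x) + ∑ i, polyLog m (U' i x)) -
      (∑ j, polyLog m (V j x) + ∑ j, polyLog m (V' j x)))) G :=
    (hXV_int.sub hXU_int).congr_fun (fun x hx => by
      show XV.integrand x - XU.integrand x = _
      rw [hsum x hx]
      ring) hGm
  set B : KZ.IntegralRep b :=
    { domain := G
      integrand := fun x => d x * ((∑ i, polyLog m (U i x) + ∑ i, polyLog m (U' i x)) -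
        (∑ j, polyLog m (V j x) + ∑ j, polyLog m (V' j x)))
      isSemialgebraic_domain := hG
      isSemialgebraicFunOn_integrand := hFsa
      integrableOn := hFint } with hB
  have rB : KZ.of XV - KZ.of B - KZ.of XU ∈ KZ.relations :=
    KZ.integrandAddRel_subset_relations ⟨b, XV, B, XU, hXVd.symm, hXUd.trans hXVd.symm,
      fun x hx => by
        rw [hXVd] at hx
        exact hsum x hx, rfl⟩
  refine ⟨B, rfl, rfl, ?_⟩
  have e : (∑ i, KZ.of (R i) - ∑ i, KZ.of (R' i)) - (∑ j, KZ.of (S j) - ∑ j, KZ.of (S' j)) - KZ.of B =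
      -(KZ.of PA - ∑ i, KZ.of (R i) - KZ.of BA) - (-KZ.of PC + ∑ i, KZ.of (R' i) - KZ.of BC) +
        (KZ.of PB - ∑ j, KZ.of (S j) - KZ.of BB) + (-KZ.of PD + ∑ j, KZ.of (S' j) - KZ.of BD) -
        (-KZ.of PA + KZ.of PC + KZ.of PB - KZ.of PD - KZ.of BAC + KZ.of BBD) -
        (KZ.of XV - KZ.of BB - KZ.of BD - KZ.of BBD) + (KZ.of XU - KZ.of BA - KZ.of BC - KZ.of BAC) +
        (KZ.of XV - KZ.of B - KZ.of XU) := by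
    abel
  rw [e]
  exact add_mem (add_mem (sub_mem (sub_mem (add_mem (add_mem (sub_mem (neg_mem h1) h2) h3) h4) h56) rV) rU) rB

/-! ### §3s END-TO-END TEST (i) of the critic: a MIXED-ORIENTATION family decided —
`[(0,1)², −x²/(1+x) + x²θ/(1+θx) + (x²/(1+x)²)·θ/(1 − θx/(1+x))] ∈ KZ.relations` — PROVED

`κ_P = x > 0` (cell `W_P = 1+x > 1`), `κ_N = −x/(1+x) ∈ (−1,0)` (REVERSED cell `W_N = 1/(1+x) < 1`), `M = 1`,
`c_P = κ_P²`, `c_N = κ_N²` (so both regularised coefficients are `1`), and the exact relation `W_P · W_N = 1` couples a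
cell of each orientation.  Fibre integral: `−x²/(1+x) + (κ_P − log W_P) + (κ_N − log W_N) = −x²/(1+x) + κ_P + κ_N ≡ 0`.
Decided by: integrand split, open→closed, D4 in BOTH orientations (§3k, §3k′), the general D7 theorem §3r with
`U = (W_P)`, `U' = (W_N)`, `V = V' = ∅` (one `Mixed₁` junction inside), Newton–Leibniz for `a₀`, base cancellation. -/

namespace MixedInstance

open DegenerateInstance

/-- `c_P = x²`. -/
def cP : (Fin 1 → ℝ) → ℝ := fun x => x 0 ^ 2
/-- `κ_P = x`. -/
def κP : (Fin 1 → ℝ) → ℝ := fun x => x 0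
/-- `c_N = x²/(1+x)²`. -/
def cN : (Fin 1 → ℝ) → ℝ := fun x => x 0 ^ 2 / (1 + x 0) ^ 2
/-- `κ_N = −x/(1+x)`. -/
def κN : (Fin 1 → ℝ) → ℝ := fun x => -x 0 / (1 + x 0)
/-- `a₀ = −x²/(1+x)`. -/
def a₀ : (Fin 1 → ℝ) → ℝ := fun x => -x 0 ^ 2 / (1 + x 0)

/-- Auxiliary step `one_add_ne`. [bookkeeping] -/
theorem one_add_ne : ∀ x ∈ G, (1 : ℝ) + x 0 ≠ 0 := fun x hx => by
  have := hx.1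
  positivity

/-- Auxiliary step `sa_cP`. [bookkeeping] -/
theorem sa_cP : IsSemialgebraicFunOn ℚ G cP :=
  (isSemialgebraicFunOn_pow' isSemialgebraic_G sa_x 2).congr fun _ _ => rfl

/-- Auxiliary step `sa_κP`. [bookkeeping] -/
theorem sa_κP : IsSemialgebraicFunOn ℚ G κP := sa_x.congr fun _ _ => rfl

/-- Auxiliary step `sa_one_add`. [bookkeeping] -/
theorem sa_one_add : IsSemialgebraicFunOn ℚ G (fun x => 1 + x 0) :=
  (IsSemialgebraicFunOn.add_holds (isSemialgebraicFunOn_ratCast isSemialgebraic_G 1) sa_x).congr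
    fun _ _ => by simp

/-- Auxiliary step `sa_cN`. [bookkeeping] -/
theorem sa_cN : IsSemialgebraicFunOn ℚ G cN :=
  (IsSemialgebraicFunOn.div (isSemialgebraicFunOn_pow' isSemialgebraic_G sa_x 2)
    (isSemialgebraicFunOn_pow' isSemialgebraic_G sa_one_add 2)
    fun x hx => pow_ne_zero _ (one_add_ne x hx)).congr fun _ _ => rfl

/-- Auxiliary step `sa_κN`. [bookkeeping] -/
theorem sa_κN : IsSemialgebraicFunOn ℚ G κN :=
  (IsSemialgebraicFunOn.div sa_x.neg sa_one_add one_add_ne).congr fun _ _ => rfl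

/-- Auxiliary step `sa_a₀`. [bookkeeping] -/
theorem sa_a₀ : IsSemialgebraicFunOn ℚ G a₀ :=
  (IsSemialgebraicFunOn.div (isSemialgebraicFunOn_pow' isSemialgebraic_G sa_x 2).neg sa_one_add
    one_add_ne).congr fun _ _ => rfl

/-- Auxiliary step `κP_pos`. [bookkeeping] -/
theorem κP_pos : ∀ x ∈ G, 0 < κP x := fun _ hx => hx.1

end MixedInstance
end CylLog
end RegularisedLogLayer
end Summit.KontsevichZagierPeriods.RootDecompRelativeModAbsolute.Rung30571
end
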